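import Summits.Ventures.PercRepro.MSTightTwoFamily

/-!
# The halves of a tight family are tight; the halves of an excess-one family have excess ≤ 1

Dossier proofs/MINE1-theoremS.md, Addendum 49 (corollaries of the two-family Marica–Schönheim
inequality, `MSTightTwoFamily`). For a family `F` and an element `r` (`F₀ = part0 r F`,
`F₁ = partr r F`), `|D(F₀)| + |F₁| ≤ |D(F)|` and `|D(F₁)| + |F₀| ≤ |D(F)|`
(`card_diffs_part0_add_card_partr_le`, `card_diffs_partr_add_card_part0_le`) give, with
`|F| = |F₀| + |F₁|`: the excess `|D(G)| − |G|` of each half is at most the excess of `F`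
(`card_diffs_part0_sub_le`, `card_diffs_partr_sub_le`, in the subtraction-free form
`|D(F₀)| + |F| ≤ |D(F)| + |F₀|`); in particular **the two halves of a tight family are tight**
(`tight_part0_of_tight`, `tight_partr_of_tight` — Theorem S's Corollary (iii), now without
Theorem S) and **the two halves of an excess-one family have excess at most one**
(`card_diffs_part0_le_succ_of_excess_one`, `card_diffs_partr_le_succ_of_excess_one` — the
statement (H8) of the dossier, at every direction, tightening or not).
-/

namespace PercRepro.MSTight

open Finset
open scoped FinsetFamily

variable {α : Type*} [DecidableEq α]

/-- `|D(F₀)| + |F| ≤ |D(F)| + |F₀|`: the excess of the `r`-free half is at most the excess of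
`F`. -/
theorem card_diffs_part0_sub_le (r : α) (F : Finset (Finset α)) :
    (part0 r F \\ part0 r F).card + F.card ≤ (F \\ F).card + (part0 r F).card := by
  have h := card_diffs_part0_add_card_partr_le r F
  have hc := card_eq_card_part0_add_card_partr r F
  omega

/-- `|D(F₁)| + |F| ≤ |D(F)| + |F₁|`: the excess of the `r`-half is at most the excess of `F`. -/
theorem card_diffs_partr_sub_le (r : α) (F : Finset (Finset α)) :
    (partr r F \\ partr r F).card + F.card ≤ (F \\ F).card + (partr r F).card := by
  have h := card_diffs_partr_add_card_part0_le r F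
  have hc := card_eq_card_part0_add_card_partr r F
  omega

/-- **The `r`-free half of a tight family is tight.** -/
theorem tight_part0_of_tight {r : α} {F : Finset (Finset α)} (hF : Tight F) :
    Tight (part0 r F) := by
  have h := card_diffs_part0_sub_le r F
  have hMS := Finset.card_le_card_diffs (part0 r F)
  unfold Tight at hF ⊢
  omega

/-- **The `r`-half of a tight family is tight.** -/
theorem tight_partr_of_tight {r : α} {F : Finset (Finset α)} (hF : Tight F) :
    Tight (partr r F) := by
  have h := card_diffs_partr_sub_le r F
  have hMS := Finset.card_le_card_diffs (partr r F)
  unfold Tight at hF ⊢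
  omega

/-- **(H8) for the `r`-free half**: the `r`-free half of an excess-one family has excess at most
one, at every direction. -/
theorem card_diffs_part0_le_succ_of_excess_one {r : α} {F : Finset (Finset α)}
    (hex : (F \\ F).card = F.card + 1) :
    (part0 r F \\ part0 r F).card ≤ (part0 r F).card + 1 := by
  have h := card_diffs_part0_sub_le r F
  omega

/-- **(H8) for the `r`-half**: the `r`-half of an excess-one family has excess at most one, at
every direction. -/
theorem card_diffs_partr_le_succ_of_excess_one {r : α} {F : Finset (Finset α)}
    (hex : (F \\ F).card = F.card + 1) :
    (partr r F \\ partr r F).card ≤ (partr r F).card + 1 := by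
  have h := card_diffs_partr_sub_le r F
  omega

/-- At a direction of an excess-one family, a half of excess one forces every `r`-free
difference of `F` to be a difference of one of the halves: `X ⊆ D(F₀) ∪ D(F₁)`
(the refined two-family bound leaves no room for `X \ (D(F₀) ∪ D(F₁))`). -/
theorem diffsX_subset_of_excess_one_of_part0_not_tight {r : α} {F : Finset (Finset α)}
    (hex : (F \\ F).card = F.card + 1)
    (h0 : (part0 r F \\ part0 r F).card = (part0 r F).card + 1) :
    diffsX r F ⊆ part0 r F \\ part0 r F ∪ partr r F \\ partr r F := by
  have h := card_diffs_part0_add_card_partr_le r F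
  have hc := card_eq_card_part0_add_card_partr r F
  have hz : (diffsX r F \ (part0 r F \\ part0 r F ∪ partr r F \\ partr r F)).card = 0 := by
    omega
  rw [Finset.card_eq_zero, Finset.sdiff_eq_empty_iff_subset] at hz
  exact hz

/-- The mirror: a half `F₁` of excess one forces `X ⊆ D(F₀) ∪ D(F₁)`. -/
theorem diffsX_subset_of_excess_one_of_partr_not_tight {r : α} {F : Finset (Finset α)}
    (hex : (F \\ F).card = F.card + 1)
    (h1 : (partr r F \\ partr r F).card = (partr r F).card + 1) :
    diffsX r F ⊆ part0 r F \\ part0 r F ∪ partr r F \\ partr r F := by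
  have h := card_diffs_partr_add_card_part0_le r F
  have hc := card_eq_card_part0_add_card_partr r F
  have hz : (diffsX r F \ (part0 r F \\ part0 r F ∪ partr r F \\ partr r F)).card = 0 := by
    omega
  rw [Finset.card_eq_zero, Finset.sdiff_eq_empty_iff_subset] at hz
  exact hz

end PercRepro.MSTight
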